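import Mathlib
import Literature.NumberTheory.Transcendental.SchanuelEclEmptyProofs
import Literature.Barriers.Schanuel.AlgebraicIndependenceOfLogarithms
import Summits.Schanuel.Schanuel.Theses.RootDecomp1B
import Summits.Schanuel.Schanuel.Theorems.RootDecomp1CAxisReductionNormalForm

/-!
# RootDecomp1B — support item `PolarOfConjStable` (stmt-Schanuel-24626): the quarter-turn step

Every conjugation-stable counterexample to Schanuel yields a Klein-polar counterexample `(r, i·r)`,
`r : Fin m → ℝ` ℚ-free, `trdeg ℚ(r, ir, e^r, e^{ir}) < 2m`.  (1) σ-normal form (`exists_axis_tuple_of_conj_stable`,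
landed with route 1C's axis reduction) + clearing denominators: the conjugation-stable span carries an AXIS
counterexample `a` (`trdeg ℚ(a, e^a) < p`).  (2) Quarter turn: `R, J ⊂ ℝ` = ℚ-spans of the real coordinates /
of the imaginary parts of the imaginary coordinates of `a`, `T = R + J` (`m = dim T`, `c₀ = dim R ∩ J`,
`dim R + dim J = m + c₀ ≥ p`), complements `R = (R ∩ J) ⊕ R₁`, `J = (R ∩ J) ⊕ J₁` with bases `α`, `β`; for a
ℚ-basis `r` of `T` every generator of `ℚ(r, ir, e^r, e^{ir})` is algebraic over `ℚ(a, e^a, New, i)`,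
`New = {e^{β_k}} ∪ {e^{iα_k}}` (`e^ρ`, `e^{iσ}` are algebraic over `ℚ(a, e^a)` for `ρ ∈ R`, `σ ∈ J`; the cross
terms `e^{iρ}`, `e^σ` are free on `R ∩ J` and cost one exponential per basis vector of `R₁`, `J₁`), so
`trdeg ≤ (p − 1) + (dim R + dim J − 2c₀) ≤ 2m − 1`.  Census seat (prover role), cell decomp-schanuel; 0 sorry.
-/

set_option linter.dupNamespace false

noncomputable section

open Complex IntermediateField Cardinal
open scoped ComplexConjugate

namespace Summit.Schanuel.Schanuel.Theorems.RootDecomp1BPolarOfConjStable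

open Summit.Schanuel.Schanuel.Theses.RootDecomp1B
open Summit.Schanuel.Schanuel.Theorems.RootDecomp1CAxisReduction (exists_axis_tuple_of_conj_stable)
open Literature.NumberTheory.Transcendental (exists_nsmul_mem_span_int mem_adjoin_of_mem_span_int
  isAlgebraic_adjoin_over_algebraAdjoin)

/-- If every `x i` lies in a subfield `K`, so does every element of `span_ℚ (range x)`. -/
theorem mem_of_mem_span {ι : Type*} (x : ι → ℂ) (K : IntermediateField ℚ ℂ) (hx : ∀ i, x i ∈ K)
    {v : ℂ} (hv : v ∈ Submodule.span ℚ (Set.range x)) : v ∈ K := by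
  have hle : Submodule.span ℚ (Set.range x) ≤ K.toSubalgebra.toSubmodule := by
    rw [Submodule.span_le]; rintro _ ⟨i, rfl⟩; exact hx i
  exact hle hv

/-- If every `x i` and every `e^{x i}` lies in `K`, then `e^v` is algebraic over `K` for every
`v ∈ span_ℚ (range x)` (a positive integer multiple `N v` lies in the `ℤ`-span, and `(e^v)^N = e^{Nv} ∈ K`). -/
theorem cexp_isAlgebraic_of_mem_span {ι : Type*} (x : ι → ℂ) (K : IntermediateField ℚ ℂ)
    (hx : ∀ i, x i ∈ K) (hex : ∀ i, cexp (x i) ∈ K)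
    {v : ℂ} (hv : v ∈ Submodule.span ℚ (Set.range x)) : IsAlgebraic K (cexp v) := by
  obtain ⟨N, hN, hNv⟩ := exists_nsmul_mem_span_int x hv
  have hle : adjoin ℚ (Set.range x ∪ Set.range (cexp ∘ x)) ≤ K := by
    rw [adjoin_le_iff]; rintro _ (⟨i, rfl⟩ | ⟨i, rfl⟩); exacts [hx i, hex i]
  have hmem : cexp ((N : ℚ) • v) ∈ K := hle (mem_adjoin_of_mem_span_int x hNv).2
  have hpow : cexp ((N : ℚ) • v) = cexp v ^ N := by
    rw [Nat.cast_smul_eq_nsmul, nsmul_eq_mul, Complex.exp_nat_mul]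
  rw [hpow] at hmem
  exact IsAlgebraic.of_pow (Nat.pos_of_ne_zero hN) (isAlgebraic_algebraMap (⟨_, hmem⟩ : K))

set_option maxHeartbeats 800000 in
set_option synthInstance.maxHeartbeats 400000 in
/-- **Quarter turn.** A ℚ-free AXIS tuple `a` (every coordinate real or purely imaginary) with
`trdeg ℚ(a, e^a) < p` yields a ℚ-free real `r : Fin m → ℝ` with `trdeg ℚ(r, ir, e^r, e^{ir}) < m + m`. -/
theorem polar_of_axis (p : ℕ) (a : Fin p → ℂ) (haxis : ∀ i, (a i).im = 0 ∨ (a i).re = 0)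
    (ha : LinearIndependent ℚ a)
    (hlt : Algebra.trdeg ℚ ↥(adjoin ℚ (Set.range a ∪ Set.range (cexp ∘ a))) < (p : Cardinal)) :
    ∃ (m : ℕ) (r : Fin m → ℝ), LinearIndependent ℚ r ∧
      Algebra.trdeg ℚ ↥(adjoin ℚ (Set.range (Fin.append (fun j => ((r j : ℝ) : ℂ)) (fun j => ((r j : ℝ) : ℂ) * I)) ∪
        Set.range (cexp ∘ Fin.append (fun j => ((r j : ℝ) : ℂ)) (fun j => ((r j : ℝ) : ℂ) * I)))) <
        ((m + m : ℕ) : Cardinal) := by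
  classical
  -- tower equality `trdeg K(S) + trdeg_{K(S)} K(S)(T) = trdeg K(S ∪ T)` (generic; see RootDecomp1CAxisReduction)
  have tower : ∀ {K E : Type} [Field K] [Field E] [Algebra K E] (S T : Set E),
      Algebra.trdeg K ↥(adjoin K S) + Algebra.trdeg ↥(adjoin K S) ↥(adjoin (↥(adjoin K S)) T) =
        Algebra.trdeg K ↥(adjoin K (S ∪ T)) := by
    intro K E _ _ _ S T
    haveI : FaithfulSMul (adjoin K S) (adjoin (adjoin K S) T) :=
      ⟨fun {m₁ m₂} h => (algebraMap (adjoin K S) (adjoin (adjoin K S) T)).injective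
        (by simpa [Algebra.smul_def] using h 1)⟩
    have htower := trdeg_add_eq K (adjoin K S) (A := adjoin (adjoin K S) T)
    have heq : Algebra.trdeg K (adjoin (adjoin K S) T) = Algebra.trdeg K (adjoin K (S ∪ T)) := by
      rw [← (equivOfEq (adjoin_adjoin_left K S T)).trdeg_eq]
      rfl
    rw [htower, heq]
  -- `ℚ(T')` with `T'` algebraic over an intermediate field `K` has `trdeg_ℚ ℚ(T') ≤ trdeg_ℚ K`
  have trdeg_le_of_alg : ∀ (K : IntermediateField ℚ ℂ) (T' : Set ℂ), (∀ x ∈ T', IsAlgebraic K x) →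
      Algebra.trdeg ℚ ↥(adjoin ℚ T') ≤ Algebra.trdeg ℚ ↥K := by
    intro K T' hT
    have hle : adjoin ℚ T' ≤ adjoin ℚ ((K : Set ℂ) ∪ T') := adjoin.mono ℚ _ _ Set.subset_union_right
    have hmono : Algebra.trdeg ℚ ↥(adjoin ℚ T') ≤ Algebra.trdeg ℚ ↥(adjoin ℚ ((K : Set ℂ) ∪ T')) :=
      trdeg_le_of_injective (inclusion hle) (inclusion_injective hle)
    refine hmono.trans (le_of_eq ?_)
    haveI : Algebra.IsAlgebraic K (adjoin K T') :=
      isAlgebraic_adjoin fun x hx => (hT x hx).isIntegral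
    have h := trdeg_add_eq ℚ K (A := adjoin K T')
    rw [trdeg_eq_zero (R := K) (A := adjoin K T'), add_zero] at h
    have e := (equivOfEq (restrictScalars_adjoin ℚ K T')).symm.trdeg_eq
    calc Algebra.trdeg ℚ ↥(adjoin ℚ ((K : Set ℂ) ∪ T'))
        = Algebra.trdeg ℚ ↥((adjoin K T').restrictScalars ℚ) := e
      _ = Algebra.trdeg ℚ ↥(adjoin K T') := rfl
      _ = Algebra.trdeg ℚ ↥K := h.symm
  -- a generated field has `trdeg ≤ #generators` (a transcendence basis may be chosen among them)
  have trdeg_adjoin_le_mk : ∀ (F : IntermediateField ℚ ℂ) (S : Set ℂ),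
      Algebra.trdeg ↥F ↥(adjoin ↥F S) ≤ #S := by
    intro F S
    haveI := isAlgebraic_adjoin_over_algebraAdjoin (F := ↥F) S
    exact (Algebra.IsAlgebraic.trdeg_le_cardinalMk ↥F (((↑) : adjoin ↥F S → ℂ) ⁻¹' S)).trans
      (Cardinal.mk_preimage_of_injective _ _ Subtype.val_injective)
  -- the two real coordinate tuples and the decomposition `a i = tR i + tJ i · I`
  let tR : Fin p → ℝ := fun i => if (a i).im = 0 then (a i).re else 0
  let tJ : Fin p → ℝ := fun i => if (a i).im = 0 then 0 else (a i).im
  have ha_eq : ∀ i, a i = (tR i : ℂ) + (tJ i : ℂ) * I := by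
    intro i
    by_cases h : (a i).im = 0
    · apply Complex.ext <;> simp [tR, tJ, h]
    · have hre : (a i).re = 0 := (haxis i).resolve_left h
      apply Complex.ext <;> simp [tR, tJ, h, hre]
  -- the complex copies
  let tRc : Fin p → ℂ := fun i => (tR i : ℂ)
  let tJI : Fin p → ℂ := fun i => (tJ i : ℂ) * I
  have htRc_mem : ∀ i, tRc i = a i ∨ tRc i = 0 := by
    intro i
    by_cases h : (a i).im = 0
    · left; show ((tR i : ℝ) : ℂ) = a i
      apply Complex.ext <;> simp [tR, h]
    · right; show ((tR i : ℝ) : ℂ) = 0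
      simp [tR, h]
  have htJI_mem : ∀ i, tJI i = a i ∨ tJI i = 0 := by
    intro i
    by_cases h : (a i).im = 0
    · right; show ((tJ i : ℝ) : ℂ) * I = 0
      simp [tJ, h]
    · left; show ((tJ i : ℝ) : ℂ) * I = a i
      have hre : (a i).re = 0 := (haxis i).resolve_left h
      apply Complex.ext <;> simp [tJ, h, hre]
  -- the ℚ-subspaces of ℝ
  set R : Submodule ℚ ℝ := Submodule.span ℚ (Set.range tR) with hR
  set J : Submodule ℚ ℝ := Submodule.span ℚ (Set.range tJ) with hJ
  haveI : FiniteDimensional ℚ R := FiniteDimensional.span_of_finite ℚ (Set.finite_range tR)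
  haveI : FiniteDimensional ℚ J := FiniteDimensional.span_of_finite ℚ (Set.finite_range tJ)
  set T : Submodule ℚ ℝ := R ⊔ J with hT
  set W : Submodule ℚ ℝ := R ⊓ J with hW
  haveI : FiniteDimensional ℚ T := Submodule.finiteDimensional_sup R J
  haveI : FiniteDimensional ℚ W := Submodule.finiteDimensional_of_le inf_le_left
  -- ℚ-linear maps ℝ → ℂ : `v ↦ v` and `v ↦ v·I`
  let ofQ : ℝ →ₗ[ℚ] ℂ := Complex.ofRealHom.toRatAlgHom.toLinearMap
  let ofQI : ℝ →ₗ[ℚ] ℂ := (LinearMap.mulRight ℚ I).comp ofQ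
  -- dimension count: p ≤ dim R + dim J
  set fR := Module.finrank ℚ R
  set fJ := Module.finrank ℚ J
  set c₀ := Module.finrank ℚ W
  set m := Module.finrank ℚ T
  have hRJ : m + c₀ = fR + fJ := Submodule.finrank_sup_add_finrank_inf_eq R J
  have hp : p ≤ fR + fJ := by
    set V : Submodule ℚ ℂ := Submodule.span ℚ (Set.range a) with hV
    haveI : FiniteDimensional ℚ ↥(R.map ofQ) := Module.Finite.map _ _
    haveI : FiniteDimensional ℚ ↥(J.map ofQI) := Module.Finite.map _ _
    have hVle : V ≤ R.map ofQ ⊔ J.map ofQI := by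
      rw [hV, Submodule.span_le]
      rintro _ ⟨i, rfl⟩
      rw [ha_eq i]
      refine Submodule.add_mem_sup ?_ ?_
      · exact ⟨tR i, Submodule.subset_span ⟨i, rfl⟩, rfl⟩
      · exact ⟨tJ i, Submodule.subset_span ⟨i, rfl⟩, rfl⟩
    haveI : FiniteDimensional ℚ ↥(R.map ofQ ⊔ J.map ofQI) := Submodule.finiteDimensional_sup _ _
    calc p = Module.finrank ℚ V := by rw [hV, finrank_span_eq_card ha, Fintype.card_fin]
      _ ≤ Module.finrank ℚ ↥(R.map ofQ ⊔ J.map ofQI) := Submodule.finrank_mono hVle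
      _ ≤ Module.finrank ℚ ↥(R.map ofQ) + Module.finrank ℚ ↥(J.map ofQI) :=
          Submodule.finrank_add_le_finrank_add_finrank _ _
      _ ≤ fR + fJ := add_le_add (Submodule.finrank_map_le _ _) (Submodule.finrank_map_le _ _)
  -- complements `R = W ⊕ R₁`, `J = W ⊕ J₁`
  obtain ⟨U', hU'⟩ := W.exists_isCompl
  set R₁ : Submodule ℚ ℝ := R ⊓ U' with hR₁
  set J₁ : Submodule ℚ ℝ := J ⊓ U' with hJ₁
  haveI : FiniteDimensional ℚ R₁ := Submodule.finiteDimensional_of_le inf_le_left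
  haveI : FiniteDimensional ℚ J₁ := Submodule.finiteDimensional_of_le inf_le_left
  have hWR₁ : W ⊔ R₁ = R := by
    rw [hR₁, inf_comm, ← sup_inf_assoc_of_le U' (inf_le_left : W ≤ R), hU'.sup_eq_top, top_inf_eq]
  have hWJ₁ : W ⊔ J₁ = J := by
    rw [hJ₁, inf_comm, ← sup_inf_assoc_of_le U' (inf_le_right : W ≤ J), hU'.sup_eq_top, top_inf_eq]
  have hWR₁d : Disjoint W R₁ := hU'.disjoint.mono_right inf_le_right
  have hWJ₁d : Disjoint W J₁ := hU'.disjoint.mono_right inf_le_right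
  set n₁ := Module.finrank ℚ R₁
  set n₂ := Module.finrank ℚ J₁
  have hn₁ : c₀ + n₁ = fR := by
    have h1 := Submodule.finrank_sup_add_finrank_inf_eq W R₁
    rw [hWR₁d.eq_bot, finrank_bot, add_zero, hWR₁] at h1
    exact h1.symm
  have hn₂ : c₀ + n₂ = fJ := by
    have h1 := Submodule.finrank_sup_add_finrank_inf_eq W J₁
    rw [hWJ₁d.eq_bot, finrank_bot, add_zero, hWJ₁] at h1
    exact h1.symm
  -- bases: `α` of `R₁`, `β` of `J₁`, `r` of `T`
  let bR := Module.finBasis ℚ R₁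
  let bJ := Module.finBasis ℚ J₁
  let bT := Module.finBasis ℚ T
  let α : Fin n₁ → ℝ := fun k => (bR k : ℝ)
  let β : Fin n₂ → ℝ := fun k => (bJ k : ℝ)
  let r : Fin m → ℝ := fun j => (bT j : ℝ)
  have hr_li : LinearIndependent ℚ r := bT.linearIndependent.map' T.subtype T.ker_subtype
  have hα_span : Submodule.span ℚ (Set.range α) = R₁ := by
    have : Set.range α = R₁.subtype '' Set.range bR := by rw [← Set.range_comp]; rfl
    rw [this, Submodule.span_image, bR.span_eq, Submodule.map_top, Submodule.range_subtype]
  have hβ_span : Submodule.span ℚ (Set.range β) = J₁ := by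
    have : Set.range β = J₁.subtype '' Set.range bJ := by rw [← Set.range_comp]; rfl
    rw [this, Submodule.span_image, bJ.span_eq, Submodule.map_top, Submodule.range_subtype]
  let αI : Fin n₁ → ℂ := fun k => (α k : ℂ) * I
  let βc : Fin n₂ → ℂ := fun k => (β k : ℂ)
  -- the new exponentials and the comparison field `K₁ = ℚ(a, e^a, New, I)`
  set Sa : Set ℂ := Set.range a ∪ Set.range (cexp ∘ a) with hSa
  set New : Set ℂ := Set.range (cexp ∘ βc) ∪ Set.range (cexp ∘ αI) with hNew
  set K₁ : IntermediateField ℚ ℂ := adjoin ℚ ((Sa ∪ New) ∪ {I}) with hK₁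
  have hI : I ∈ K₁ := subset_adjoin ℚ _ (Or.inr rfl)
  have ha_mem : ∀ i, a i ∈ K₁ := fun i => subset_adjoin ℚ _ (Or.inl (Or.inl (Or.inl ⟨i, rfl⟩)))
  have hea_mem : ∀ i, cexp (a i) ∈ K₁ := fun i => subset_adjoin ℚ _ (Or.inl (Or.inl (Or.inr ⟨i, rfl⟩)))
  have htRc_K : ∀ i, tRc i ∈ K₁ := by
    intro i; rcases htRc_mem i with h | h
    · rw [h]; exact ha_mem i
    · rw [h]; exact zero_mem _
  have hetRc_K : ∀ i, cexp (tRc i) ∈ K₁ := by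
    intro i; rcases htRc_mem i with h | h
    · rw [h]; exact hea_mem i
    · rw [h, Complex.exp_zero]; exact one_mem _
  have htJI_K : ∀ i, tJI i ∈ K₁ := by
    intro i; rcases htJI_mem i with h | h
    · rw [h]; exact ha_mem i
    · rw [h]; exact zero_mem _
  have hetJI_K : ∀ i, cexp (tJI i) ∈ K₁ := by
    intro i; rcases htJI_mem i with h | h
    · rw [h]; exact hea_mem i
    · rw [h, Complex.exp_zero]; exact one_mem _
  have htJc_K : ∀ i, ((tJ i : ℝ) : ℂ) ∈ K₁ := by
    intro i
    have h1 : ((tJ i : ℝ) : ℂ) = tJI i * (-I) := by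
      show ((tJ i : ℝ) : ℂ) = ((tJ i : ℝ) : ℂ) * I * (-I)
      rw [mul_assoc, mul_neg, Complex.I_mul_I, neg_neg, mul_one]
    rw [h1]
    exact mul_mem (htJI_K i) (neg_mem hI)
  -- transport of spans from ℝ to ℂ
  have span_ofQ : ∀ {ι : Type} (t : ι → ℝ) {v : ℝ}, v ∈ Submodule.span ℚ (Set.range t) →
      (v : ℂ) ∈ Submodule.span ℚ (Set.range fun i => (t i : ℂ)) := by
    intro ι t v hv
    have h := Submodule.mem_map_of_mem (f := ofQ) hv
    rw [Submodule.map_span, ← Set.range_comp] at h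
    exact h
  have span_ofQI : ∀ {ι : Type} (t : ι → ℝ) {v : ℝ}, v ∈ Submodule.span ℚ (Set.range t) →
      (v : ℂ) * I ∈ Submodule.span ℚ (Set.range fun i => (t i : ℂ) * I) := by
    intro ι t v hv
    have h := Submodule.mem_map_of_mem (f := ofQI) hv
    rw [Submodule.map_span, ← Set.range_comp] at h
    exact h
  -- membership of real vectors of `R` and `J` (as complex numbers) in `K₁`
  have hR_K : ∀ v ∈ R, (v : ℂ) ∈ K₁ := fun v hv =>
    mem_of_mem_span tRc K₁ htRc_K (span_ofQ tR hv)
  have hJ_K : ∀ v ∈ J, (v : ℂ) ∈ K₁ := fun v hv =>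
    mem_of_mem_span (fun i => ((tJ i : ℝ) : ℂ)) K₁ htJc_K (span_ofQ tJ hv)
  have hT_K : ∀ v ∈ T, (v : ℂ) ∈ K₁ := by
    intro v hv
    obtain ⟨ρ, hρ, σ, hσ, rfl⟩ := Submodule.mem_sup.mp hv
    push_cast
    exact add_mem (hR_K ρ hρ) (hJ_K σ hσ)
  have hαI_K : ∀ k, αI k ∈ K₁ := fun k =>
    mul_mem (hR_K _ (inf_le_left (b := U') (bR k).2)) hI
  have hβc_K : ∀ k, βc k ∈ K₁ := fun k => hJ_K _ (inf_le_left (b := U') (bJ k).2)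
  have heαI_K : ∀ k, cexp (αI k) ∈ K₁ := fun k =>
    subset_adjoin ℚ _ (Or.inl (Or.inr (Or.inr ⟨k, rfl⟩)))
  have heβc_K : ∀ k, cexp (βc k) ∈ K₁ := fun k =>
    subset_adjoin ℚ _ (Or.inl (Or.inr (Or.inl ⟨k, rfl⟩)))
  -- exponentials: `e^ρ` (ρ ∈ R), `e^{σ I}` (σ ∈ J) are algebraic over `K₁`; cross terms via `W`, `R₁`, `J₁`
  have heR : ∀ ρ ∈ R, IsAlgebraic K₁ (cexp (ρ : ℂ)) := fun ρ hρ =>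
    cexp_isAlgebraic_of_mem_span tRc K₁ htRc_K hetRc_K (span_ofQ tR hρ)
  have heJI : ∀ σ ∈ J, IsAlgebraic K₁ (cexp ((σ : ℂ) * I)) := fun σ hσ =>
    cexp_isAlgebraic_of_mem_span tJI K₁ htJI_K hetJI_K (span_ofQI tJ hσ)
  have heR₁I : ∀ ρ ∈ R₁, IsAlgebraic K₁ (cexp ((ρ : ℂ) * I)) := by
    intro ρ hρ
    rw [← hα_span] at hρ
    exact cexp_isAlgebraic_of_mem_span αI K₁ hαI_K heαI_K (span_ofQI α hρ)
  have heJ₁ : ∀ σ ∈ J₁, IsAlgebraic K₁ (cexp (σ : ℂ)) := by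
    intro σ hσ
    rw [← hβ_span] at hσ
    exact cexp_isAlgebraic_of_mem_span βc K₁ hβc_K heβc_K (span_ofQ β hσ)
  have heRI : ∀ ρ ∈ R, IsAlgebraic K₁ (cexp ((ρ : ℂ) * I)) := by
    intro ρ hρ
    rw [← hWR₁] at hρ
    obtain ⟨τ, hτ, ρ₁, hρ₁, rfl⟩ := Submodule.mem_sup.mp hρ
    have : cexp (((τ + ρ₁ : ℝ) : ℂ) * I) = cexp ((τ : ℂ) * I) * cexp ((ρ₁ : ℂ) * I) := by
      rw [← Complex.exp_add]; push_cast; ring_nf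
    rw [this]
    exact (heJI τ hτ.2).mul (heR₁I ρ₁ hρ₁)
  have heJ : ∀ σ ∈ J, IsAlgebraic K₁ (cexp (σ : ℂ)) := by
    intro σ hσ
    rw [← hWJ₁] at hσ
    obtain ⟨τ, hτ, σ₁, hσ₁, rfl⟩ := Submodule.mem_sup.mp hσ
    have : cexp ((τ + σ₁ : ℝ) : ℂ) = cexp (τ : ℂ) * cexp (σ₁ : ℂ) := by
      rw [← Complex.exp_add]; push_cast; ring_nf
    rw [this]
    exact (heR τ hτ.1).mul (heJ₁ σ₁ hσ₁)
  have heT : ∀ v ∈ T, IsAlgebraic K₁ (cexp (v : ℂ)) ∧ IsAlgebraic K₁ (cexp ((v : ℂ) * I)) := by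
    intro v hv
    obtain ⟨ρ, hρ, σ, hσ, rfl⟩ := Submodule.mem_sup.mp hv
    constructor
    · have : cexp ((ρ + σ : ℝ) : ℂ) = cexp (ρ : ℂ) * cexp (σ : ℂ) := by
        rw [← Complex.exp_add]; push_cast; ring_nf
      rw [this]; exact (heR ρ hρ).mul (heJ σ hσ)
    · have : cexp (((ρ + σ : ℝ) : ℂ) * I) = cexp ((ρ : ℂ) * I) * cexp ((σ : ℂ) * I) := by
        rw [← Complex.exp_add]; push_cast; ring_nf
      rw [this]; exact (heRI ρ hρ).mul (heJI σ hσ)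
  -- every generator of `G = ℚ(r, rI, e^r, e^{rI})` is algebraic over `K₁`
  set SG : Set ℂ := Set.range (Fin.append (fun j => ((r j : ℝ) : ℂ)) (fun j => ((r j : ℝ) : ℂ) * I)) ∪
    Set.range (cexp ∘ Fin.append (fun j => ((r j : ℝ) : ℂ)) (fun j => ((r j : ℝ) : ℂ) * I)) with hSG
  have hr_T : ∀ j, r j ∈ T := fun j => (bT j).2
  have hgen : ∀ x ∈ SG, IsAlgebraic K₁ x := by
    rintro x (⟨i, rfl⟩ | ⟨i, rfl⟩)
    · refine Fin.addCases (fun j => ?_) (fun j => ?_) i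
      · rw [Fin.append_left]
        exact isAlgebraic_algebraMap (⟨_, hT_K _ (hr_T j)⟩ : K₁)
      · rw [Fin.append_right]
        exact isAlgebraic_algebraMap (⟨_, mul_mem (hT_K _ (hr_T j)) hI⟩ : K₁)
    · refine Fin.addCases (fun j => ?_) (fun j => ?_) i
      · simp only [Function.comp_apply, Fin.append_left]
        exact (heT _ (hr_T j)).1
      · simp only [Function.comp_apply, Fin.append_right]
        exact (heT _ (hr_T j)).2
  -- count
  have hG_le : Algebra.trdeg ℚ ↥(adjoin ℚ SG) ≤ Algebra.trdeg ℚ ↥K₁ := trdeg_le_of_alg K₁ SG hgen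
  have hI_alg : IsAlgebraic ℚ I := by
    refine ⟨Polynomial.X ^ 2 + Polynomial.C 1, (Polynomial.monic_X_pow_add_C (1 : ℚ) two_ne_zero).ne_zero, ?_⟩
    simp [Complex.I_sq]
  have hK₁_eq : Algebra.trdeg ℚ ↥K₁ = Algebra.trdeg ℚ ↥(adjoin ℚ (Sa ∪ New)) := by
    rw [hK₁]
    exact Literature.Barriers.Schanuel.trdeg_adjoin_union_eq_of_isAlgebraic (Sa ∪ New) {I}
      (fun x hx => by rw [Set.mem_singleton_iff.mp hx]; exact hI_alg)
  have hNew_card : #New ≤ ((n₂ + n₁ : ℕ) : Cardinal) := by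
    rw [hNew]
    refine (Cardinal.mk_union_le _ _).trans ?_
    push_cast
    exact add_le_add (Cardinal.mk_range_le.trans (by simp)) (Cardinal.mk_range_le.trans (by simp))
  have htow : Algebra.trdeg ℚ ↥(adjoin ℚ Sa) + Algebra.trdeg ↥(adjoin ℚ Sa) ↥(adjoin (↥(adjoin ℚ Sa)) New) =
      Algebra.trdeg ℚ ↥(adjoin ℚ (Sa ∪ New)) := by
    exact tower (K := ℚ) Sa New
  have hSaNew : Algebra.trdeg ℚ ↥(adjoin ℚ (Sa ∪ New)) ≤
      Algebra.trdeg ℚ ↥(adjoin ℚ Sa) + ((n₂ + n₁ : ℕ) : Cardinal) :=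
    calc Algebra.trdeg ℚ ↥(adjoin ℚ (Sa ∪ New))
        = Algebra.trdeg ℚ ↥(adjoin ℚ Sa) + Algebra.trdeg ↥(adjoin ℚ Sa) ↥(adjoin (↥(adjoin ℚ Sa)) New) :=
          htow.symm
      _ ≤ Algebra.trdeg ℚ ↥(adjoin ℚ Sa) + ((n₂ + n₁ : ℕ) : Cardinal) :=
          add_le_add le_rfl ((trdeg_adjoin_le_mk (adjoin ℚ Sa) New).trans hNew_card)
  -- finite arithmetic
  obtain ⟨tF, htF⟩ := Cardinal.lt_aleph0.mp (hlt.trans (Cardinal.natCast_lt_aleph0))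
  have htFp : tF < p := by rw [htF] at hlt; exact_mod_cast hlt
  refine ⟨m, r, hr_li, ?_⟩
  calc Algebra.trdeg ℚ ↥(adjoin ℚ SG) ≤ Algebra.trdeg ℚ ↥K₁ := hG_le
    _ = Algebra.trdeg ℚ ↥(adjoin ℚ (Sa ∪ New)) := hK₁_eq
    _ ≤ Algebra.trdeg ℚ ↥(adjoin ℚ Sa) + ((n₂ + n₁ : ℕ) : Cardinal) := hSaNew
    _ = ((tF + (n₂ + n₁) : ℕ) : Cardinal) := by rw [htF]; push_cast; rfl
    _ < ((m + m : ℕ) : Cardinal) := by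
        have : tF + (n₂ + n₁) < m + m := by omega
        exact_mod_cast this

/-- Item stmt-Schanuel-24626 (`PolarOfConjStable`, support r9 of route-Schanuel-RootDecomp1B): every
conjugation-stable counterexample to Schanuel yields a Klein-polar counterexample (σ-normal form + quarter turn). -/
theorem polarOfConjStable_holds : PolarOfConjStable := by
  intro d w hw hσ hlt
  -- (1) an axis basis of the conjugation-stable span
  obtain ⟨p, a, haxis, ha_li, ha_mem, hrank⟩ := exists_axis_tuple_of_conj_stable (Fin d) w hσ
  have hdp : d ≤ p := by
    have : Module.finrank ℚ ↥(Submodule.span ℚ (Set.range w)) = d := by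
      rw [finrank_span_eq_card hw, Fintype.card_fin]
    omega
  -- clear denominators so that `a', e^{a'} ∈ ℚ(w, e^w)`
  choose N hN hN_mem using fun i => exists_nsmul_mem_span_int w (ha_mem i)
  let a' : Fin p → ℂ := fun i => (N i : ℚ) • a i
  have ha'li : LinearIndependent ℚ a' := by
    let c : Fin p → ℚˣ := fun i => Units.mk0 (N i : ℚ) (Nat.cast_ne_zero.mpr (hN i))
    have he : c • a = a' := by
      funext i; simp only [Pi.smul_apply', c, a', Units.smul_def, Units.val_mk0]
    exact he ▸ ha_li.units_smul c
  have ha'axis : ∀ i, (a' i).im = 0 ∨ (a' i).re = 0 := by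
    intro i
    rcases haxis i with h | h
    · left; show ((N i : ℚ) • a i).im = 0
      rw [Rat.smul_def, Complex.mul_im]; simp [h]
    · right; show ((N i : ℚ) • a i).re = 0
      rw [Rat.smul_def, Complex.mul_re]; simp [h]
  set Fw : IntermediateField ℚ ℂ := adjoin ℚ (Set.range w ∪ Set.range (cexp ∘ w)) with hFw
  set Fa : IntermediateField ℚ ℂ := adjoin ℚ (Set.range a' ∪ Set.range (cexp ∘ a')) with hFa
  have hle : Fa ≤ Fw := by
    rw [hFa, adjoin_le_iff]
    rintro x (⟨i, rfl⟩ | ⟨i, rfl⟩)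
    · exact (mem_adjoin_of_mem_span_int w (hN_mem i)).1
    · exact (mem_adjoin_of_mem_span_int w (hN_mem i)).2
  have hlt' : Algebra.trdeg ℚ ↥Fa < (p : Cardinal) :=
    calc Algebra.trdeg ℚ ↥Fa ≤ Algebra.trdeg ℚ ↥Fw :=
          trdeg_le_of_injective (inclusion hle) (inclusion_injective hle)
      _ < (d : Cardinal) := hlt
      _ ≤ (p : Cardinal) := by exact_mod_cast hdp
  -- (2) quarter turn
  exact polar_of_axis p a' ha'axis ha'li hlt'

end Summit.Schanuel.Schanuel.Theorems.RootDecomp1BPolarOfConjStable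

end
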